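import Literature.MathematicalPhysics.QuantumFieldTheory.Balaban1983to89.Node00.OpsYDeltaALocal

/-!
# `Balaban1983to89.Node00.OpsYDeltaALocalProj` — the PROJECTION CALCULUS of print's local gauge projections `P_□(U) = G′_□Q′*C_□Q′G′_□` and
# `R_□(U) = I − P_□(U)` on the unit locus, and the LOCAL GAUGE CONDITION `Q′G′_□R_□ = 0` on the cube's blocks — AT def-Y's LETTERS
# (W-a, file A-2′: ring identities over `OpsYDeltaALocal`; theorem-only; NO estimate)

FRAMING (verbatim cell line):
statement-level skeleton of published theorems with citation tags; proofs where landed; nothing here is a claim about the Yang–Mills mass gap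

Sources: T. Bałaban, *Propagators for lattice gauge theories in a background field*, Commun. Math. Phys. **99** (1985) 389–434
[`Balaban1985BackgroundPropagators`, "B9"]: (3.20)–(3.21) p. 394 («R(U) … the orthogonal projection onto the subspace of λ satisfying Q′(U)G′(U)λ = 0»),
(3.25) p. 394 (`R(U) = I − G′Q′*(Q′G′²Q′*)⁻¹Q′G′`), Sect. C pp. 408–409 («G′_□(U), C_□(U) = (Q′(U)G′_□²(U)Q′*(U))⁻¹, G_□(U)»), (3.105) p. 414 and
p. 415 l. 5 (`P = G′Q′*(Q′G′²Q′*)⁻¹Q′G′`, its local version `P_□`); T. Bałaban, *Propagators and renormalization transformations for lattice gauge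
theories. II*, Commun. Math. Phys. **96** (1984) 223–250 [`Balaban1984PropagatorsII`], (2.17)–(2.20) pp. 225–226.  Unit `pub-ymgap-node00-def-Y` (def-Y gen 21).

## WHAT IS PRINTED (verbatim up to notation)
p. 394: «R(U) is the orthogonal projection onto the subspace … Q′(U)G′(U)λ = 0»; p. 394 (3.25): «R(U) = I − G′Q′*(Q′G′²Q′*)⁻¹Q′G′»; p. 409 l. 1–5:
«The operators constructed for this sequence, which we denote by G′_□(U), C_□(U) = (Q′(U)G′_□²(U)Q′*(U))⁻¹, G_□(U) …»; p. 415 l. 5: «P = G′Q′*(Q′G′²Q′*)⁻¹Q′G′»,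
with `P_□` the local version entering `DP_□D*` of (3.105) p. 414.

## WHAT THIS FILE PROVIDES (over `OpsYDeltaALocal`, file A-2: `ClocY` = C_□, `PlocY` = P_□, `RlocY` = R_□, `padXlocY` = the padded compression of
`X_□ = Q′G′_□G′_□Q′*` to the range of the block cut `P`; lattice units; theorem-only)
* §1 on the UNIT LOCUS of the padded compression (`IsUnit (padXlocY …)`) and for an idempotent block cut `P`: `C_□ X_□ P = P`, ★ `C_□ X_□ C_□ = C_□`,
  hence ★★ `P_□ ∘ P_□ = P_□`, `R_□ ∘ R_□ = R_□`, `R_□ ∘ P_□ = 0 = P_□ ∘ R_□` — `P_□`, `R_□` ARE COMPLEMENTARY IDEMPOTENTS (the algebraic half of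
  print's «orthogonal projection»; the symmetry half lives with the trace pairing, `B9Thm311ProjectionR` ∕ `B9Thm311AdjointPairs`, not here);
* §2 ★★ the LOCAL GAUGE CONDITION: `P ∘ Q′ ∘ G′_□ ∘ P_□ = P ∘ Q′ ∘ G′_□`, i.e. `P ∘ Q′(U) ∘ G′_□(U) ∘ R_□(U) = 0` — the block averages OVER THE CUBE's
  BLOCKS of `G′_□R_□λ` vanish (the local counterpart of (3.20)–(3.21) «Q′G′Rλ = 0»), its transposed face `R_□ ∘ G′_□ ∘ Q′* ∘ P = 0`, and — with NO
  invertibility — `R_□λ = λ` whenever `P(Q′G′_□λ) = 0` (`R_□` is the identity on the local subspace);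
* §3 the GLOBAL FACES at ANY site letter `G′` on the unit locus `IsUnit (X(U))`, `X = Q′G′G′Q′*`: `R ∘ R = R` and `Q′ ∘ G′ ∘ R = 0` for def-Y's (3.25)
  letter `RY i parS Gp U` — the generic-`𝔸`, generic-`G′` parents of the record-level theorems `B9Thm311ProjectionR.RY_parSymY_idempotent` ∕
  `QpY_GpY_RY_parSymY` (which supply `IsUnit` from `G ≤ U(N)` at `parSymY`; cited, not restated), reached from §1–§2 through A-2's faces
  `RlocY_one = RY`, `padXlocY_one = X`.

## HONEST SCOPE
* Ring identities only; invertibility of the padded compression (Thm 3.2 ∕ Thm 3.11 content; at the record `B9Thm39CubeOpsAtLettersY.isUnit_padX_parSymY`)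
  enters ONLY as a hypothesis, idempotency of the cut as the hypothesis `P * P = P` (for indicator cuts `cutMulY χ` it is
  `B9Thm311PosViaLocalInversesY.cutMulY_mul_self_of_zero_one`).  No symmetry ∕ positivity ∕ trace-pairing statement (Cor. 3.6-type content) is made.
* Nothing is inferred from the manuscript beyond the displayed formulas; kernel-checked.  NOT summit progress: N06 is not discharged by this file;
  no continuum limit, no OS axioms, no mass gap, no claim on the Clay problem.
* v1.1 (DOC-ONLY, 2026-08-28): the locator of C_□'s definition corrected to p. 409 l. 4–5 at 2 docstrings (v1.0's «(3.87) p.409» named the wrong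
  display) per referee ref-E READ-18; no declaration, statement or proof changed.
-/

namespace Literature.MathematicalPhysics.QuantumFieldTheory.Balaban1983to89.Node00.OpsYDeltaALocalProj

open B6KLevelCensusIndexV1 (KIdx)
open OpsYLocalInverse (GsqY dirInvY_one_left)
open OpsYDeltaALocal (padXlocY ClocY PlocY RlocY mul_ClocY ClocY_mul ClocY_mul_comprX P_mul_X_mul_ClocY RlocY_one padXlocY_one ClocY_one)

variable {𝔸 : Type} [NormedRing 𝔸] [NormedAlgebra ℂ 𝔸] [CompleteSpace 𝔸]
variable {d ℓ : ℕ} {hd : 1 ≤ d + 1} {hL : Odd (ℓ + 1) ∧ 1 < ℓ + 1} {b₀ b₁ : ℝ}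
variable (i : KIdx d ℓ hd hL b₀ b₁) (parS : SiteParY 𝔸 i) (D : Finset (SiteY i))

/-! ## §1 `P_□`, `R_□` are complementary idempotents on the unit locus -/

section BlockCut

variable {P : Module.End ℂ (BlkY i → 𝔸)} (hP : P * P = P)
include hP

/-- `C_□ · X_□ · P = P` on the unit locus (left inverse on the cube's blocks, the cut absorbed by `C_□ P = C_□`).
[cite: Balaban1985BackgroundPropagators, p.409 l.4–5 (C_□(U) = (Q′(U)G′_□²(U)Q′*(U))⁻¹; v1.1: v1.0 wrote «(3.87) p.409» — (3.87), p.409 l.12, is the partition-of-unity approximations G′₀ = Σ h_□G′_□h_□, C₀ = Σ h_□C_□h_□, G₀ = Σ h_□G_□h_□, not the definition of C_□), pp.408–409] -/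
theorem ClocY_mul_X_mul_P {U : CfgY 𝔸 i} (hU : IsUnit (padXlocY i parS D P U)) :
    ClocY i parS D P U * XY i parS (GsqY i parS D) U * P = P := by
  calc ClocY i parS D P U * XY i parS (GsqY i parS D) U * P
        = ClocY i parS D P U * P * XY i parS (GsqY i parS D) U * P := by rw [ClocY_mul i parS D hP]
    _ = ClocY i parS D P U * (P * XY i parS (GsqY i parS D) U * P) := by simp only [mul_assoc]
    _ = P := ClocY_mul_comprX i parS D hP hU

/-- ★ `C_□ · X_□ · C_□ = C_□` on the unit locus (a generalised inverse of `X_□` supported on the cube's blocks).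
[cite: Balaban1985BackgroundPropagators, p.409 l.4–5 (C_□), pp.408–409] -/
theorem ClocY_mul_X_mul_ClocY {U : CfgY 𝔸 i} (hU : IsUnit (padXlocY i parS D P U)) :
    ClocY i parS D P U * XY i parS (GsqY i parS D) U * ClocY i parS D P U = ClocY i parS D P U := by
  calc ClocY i parS D P U * XY i parS (GsqY i parS D) U * ClocY i parS D P U
        = ClocY i parS D P U * XY i parS (GsqY i parS D) U * (P * ClocY i parS D P U) := by rw [mul_ClocY i parS D hP]
    _ = ClocY i parS D P U * XY i parS (GsqY i parS D) U * P * ClocY i parS D P U := by simp only [mul_assoc]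
    _ = P * ClocY i parS D P U := by rw [ClocY_mul_X_mul_P i parS D hP hU]
    _ = ClocY i parS D P U := mul_ClocY i parS D hP U

/-- ★★ **`P_□(U)` IS AN IDEMPOTENT** on the unit locus: `P_□ ∘ P_□ = G′_□Q′*(C_□X_□C_□)Q′G′_□ = P_□`.
[cite: Balaban1985BackgroundPropagators, (3.25) p.394, p.415 l.5 (P), (3.105) p.414 (P_□)] -/
theorem PlocY_comp_PlocY {U : CfgY 𝔸 i} (hU : IsUnit (padXlocY i parS D P U)) :
    PlocY i parS D P U ∘ₗ PlocY i parS D P U = PlocY i parS D P U := by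
  have hkey : ClocY i parS D P U ∘ₗ (QpY i parS U ∘ₗ (GsqY i parS D U ∘ₗ (GsqY i parS D U ∘ₗ (QpsY i parS U ∘ₗ
      (ClocY i parS D P U ∘ₗ (QpY i parS U ∘ₗ GsqY i parS D U)))))) = ClocY i parS D P U ∘ₗ (QpY i parS U ∘ₗ GsqY i parS D U) := by
    have h := congrArg (fun S => S ∘ₗ (QpY i parS U ∘ₗ GsqY i parS D U)) (ClocY_mul_X_mul_ClocY i parS D hP hU)
    simp only [Module.End.mul_eq_comp, XY, LinearMap.comp_assoc] at h
    exact h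
  simp only [PlocY, LinearMap.comp_assoc]
  rw [hkey]

/-- `P_□ * P_□ = P_□` in `Module.End`. [cite: Balaban1985BackgroundPropagators, (3.25) p.394, p.415 l.5] -/
theorem PlocY_mul_PlocY {U : CfgY 𝔸 i} (hU : IsUnit (padXlocY i parS D P U)) :
    PlocY i parS D P U * PlocY i parS D P U = PlocY i parS D P U := by
  rw [Module.End.mul_eq_comp, PlocY_comp_PlocY i parS D hP hU]

/-- ★★ **`R_□(U)` IS AN IDEMPOTENT** on the unit locus (print: «orthogonal projection»; this is the algebraic half).
[cite: Balaban1985BackgroundPropagators, (3.20) p.394, (3.25) p.394, (3.105) p.414] -/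
theorem RlocY_comp_RlocY {U : CfgY 𝔸 i} (hU : IsUnit (padXlocY i parS D P U)) :
    RlocY i parS D P U ∘ₗ RlocY i parS D P U = RlocY i parS D P U := by
  rw [RlocY, LinearMap.sub_comp, LinearMap.id_comp, LinearMap.comp_sub, LinearMap.comp_id, PlocY_comp_PlocY i parS D hP hU, sub_self, sub_zero]

/-- `R_□ * R_□ = R_□` in `Module.End`. [cite: Balaban1985BackgroundPropagators, (3.20) p.394, (3.25) p.394] -/
theorem RlocY_mul_RlocY {U : CfgY 𝔸 i} (hU : IsUnit (padXlocY i parS D P U)) :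
    RlocY i parS D P U * RlocY i parS D P U = RlocY i parS D P U := by
  rw [Module.End.mul_eq_comp, RlocY_comp_RlocY i parS D hP hU]

/-- complementary: `R_□ ∘ P_□ = 0`. [cite: Balaban1985BackgroundPropagators, (3.25) p.394, bookkeeping] -/
theorem RlocY_comp_PlocY {U : CfgY 𝔸 i} (hU : IsUnit (padXlocY i parS D P U)) :
    RlocY i parS D P U ∘ₗ PlocY i parS D P U = 0 := by
  rw [RlocY, LinearMap.sub_comp, LinearMap.id_comp, PlocY_comp_PlocY i parS D hP hU, sub_self]

/-- complementary: `P_□ ∘ R_□ = 0`. [cite: Balaban1985BackgroundPropagators, (3.25) p.394, bookkeeping] -/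
theorem PlocY_comp_RlocY {U : CfgY 𝔸 i} (hU : IsUnit (padXlocY i parS D P U)) :
    PlocY i parS D P U ∘ₗ RlocY i parS D P U = 0 := by
  rw [RlocY, LinearMap.comp_sub, LinearMap.comp_id, PlocY_comp_PlocY i parS D hP hU, sub_self]

/-! ## §2 The local gauge condition on the cube's blocks -/

/-- `P ∘ Q′ ∘ G′_□ ∘ P_□ = P ∘ Q′ ∘ G′_□` on the unit locus (from `P X_□ C_□ = P`).
[cite: Balaban1985BackgroundPropagators, (3.20)–(3.21) p.394, (3.25) p.394, (3.105) p.414] -/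
theorem P_QpY_GsqY_comp_PlocY {U : CfgY 𝔸 i} (hU : IsUnit (padXlocY i parS D P U)) :
    P ∘ₗ QpY i parS U ∘ₗ GsqY i parS D U ∘ₗ PlocY i parS D P U = P ∘ₗ QpY i parS U ∘ₗ GsqY i parS D U := by
  have hkey : P ∘ₗ (QpY i parS U ∘ₗ (GsqY i parS D U ∘ₗ (GsqY i parS D U ∘ₗ (QpsY i parS U ∘ₗ
      (ClocY i parS D P U ∘ₗ (QpY i parS U ∘ₗ GsqY i parS D U)))))) = P ∘ₗ (QpY i parS U ∘ₗ GsqY i parS D U) := by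
    have h := congrArg (fun S => S ∘ₗ (QpY i parS U ∘ₗ GsqY i parS D U)) (P_mul_X_mul_ClocY i parS D hP hU)
    simp only [Module.End.mul_eq_comp, XY, LinearMap.comp_assoc] at h
    exact h
  simp only [PlocY]
  rw [hkey]

/-- ★★ **THE LOCAL GAUGE CONDITION: `P ∘ Q′(U) ∘ G′_□(U) ∘ R_□(U) = 0`** — the block averages over the cube's blocks of `G′_□R_□λ` vanish, for every
`λ`, on the unit locus (the local counterpart of (3.20)–(3.21) «Q′(U)G′(U)λ = 0» on the range of `R`).
[cite: Balaban1985BackgroundPropagators, (3.20)–(3.21) p.394, (3.25) p.394, (3.105) p.414] -/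
theorem P_QpY_GsqY_comp_RlocY {U : CfgY 𝔸 i} (hU : IsUnit (padXlocY i parS D P U)) :
    P ∘ₗ QpY i parS U ∘ₗ GsqY i parS D U ∘ₗ RlocY i parS D P U = 0 := by
  rw [RlocY, LinearMap.comp_sub, LinearMap.comp_sub, LinearMap.comp_sub, LinearMap.comp_id, P_QpY_GsqY_comp_PlocY i parS D hP hU, sub_self]

/-- the transposed face: `P_□ ∘ G′_□ ∘ Q′* ∘ P = G′_□ ∘ Q′* ∘ P` on the unit locus (from `C_□ X_□ P = P`).
[cite: Balaban1985BackgroundPropagators, (3.20)–(3.21) p.394, (3.25) p.394, bookkeeping] -/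
theorem PlocY_comp_GsqY_QpsY_P {U : CfgY 𝔸 i} (hU : IsUnit (padXlocY i parS D P U)) :
    PlocY i parS D P U ∘ₗ (GsqY i parS D U ∘ₗ QpsY i parS U ∘ₗ P) = GsqY i parS D U ∘ₗ QpsY i parS U ∘ₗ P := by
  have hkey : ClocY i parS D P U ∘ₗ (QpY i parS U ∘ₗ (GsqY i parS D U ∘ₗ (GsqY i parS D U ∘ₗ (QpsY i parS U ∘ₗ P)))) = P := by
    have h := ClocY_mul_X_mul_P i parS D hP hU
    simp only [Module.End.mul_eq_comp, XY, LinearMap.comp_assoc] at h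
    exact h
  simp only [PlocY, LinearMap.comp_assoc]
  rw [hkey]

/-- `R_□ ∘ G′_□ ∘ Q′* ∘ P = 0` on the unit locus. [cite: Balaban1985BackgroundPropagators, (3.20)–(3.21) p.394, (3.25) p.394, bookkeeping] -/
theorem RlocY_comp_GsqY_QpsY_P {U : CfgY 𝔸 i} (hU : IsUnit (padXlocY i parS D P U)) :
    RlocY i parS D P U ∘ₗ (GsqY i parS D U ∘ₗ QpsY i parS U ∘ₗ P) = 0 := by
  rw [RlocY, LinearMap.sub_comp, LinearMap.id_comp, PlocY_comp_GsqY_QpsY_P i parS D hP hU, sub_self]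

/-- ★ **`R_□λ = λ` WHENEVER `P(Q′G′_□λ) = 0`** — `R_□(U)` is the identity on the local subspace (any configuration; no invertibility: `C_□ = C_□ P`).
[cite: Balaban1985BackgroundPropagators, (3.20)–(3.21) p.394 («Rλ = λ» on Q′G′λ = 0), (3.25) p.394] -/
theorem RlocY_apply_of_P_QpY_GsqY_eq_zero (U : CfgY 𝔸 i) {lam : SiteY i → 𝔸} (h : P (QpY i parS U (GsqY i parS D U lam)) = 0) :
    RlocY i parS D P U lam = lam := by
  have hC : ClocY i parS D P U (QpY i parS U (GsqY i parS D U lam)) = 0 := by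
    rw [← ClocY_mul i parS D hP U, Module.End.mul_apply, h, map_zero]
  rw [RlocY, LinearMap.sub_apply, LinearMap.id_apply, PlocY, LinearMap.comp_apply, LinearMap.comp_apply, LinearMap.comp_apply,
    LinearMap.comp_apply, hC, map_zero, map_zero, sub_zero]

end BlockCut

/-! ## §3 The global faces at any site letter `G′` on the unit locus of `X(U) = Q′G′G′Q′*` -/

/-- at the trivial block cut the padded compression is `X_□` itself, so its unit locus is that of `X_□`. [cite: Balaban1985BackgroundPropagators, (3.25) p.394, bookkeeping] -/
theorem isUnit_padXlocY_one_iff (U : CfgY 𝔸 i) : IsUnit (padXlocY i parS D 1 U) ↔ IsUnit (XY i parS (GsqY i parS D) U) := by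
  rw [padXlocY_one]

/-- ★ **`R(U)[G′_□] ∘ R(U)[G′_□] = R(U)[G′_□]`** on the unit locus of `X = Q′G′_□G′_□Q′*` — def-Y's (3.25) letter at `G′ := G′_□ = GsqY i parS D` (any
transporter table, any `𝔸`). [cite: Balaban1985BackgroundPropagators, (3.20) p.394, (3.25) p.394] -/
theorem RY_GsqY_comp_RY_GsqY {U : CfgY 𝔸 i} (hU : IsUnit (XY i parS (GsqY i parS D) U)) :
    RY i parS (GsqY i parS D) U ∘ₗ RY i parS (GsqY i parS D) U = RY i parS (GsqY i parS D) U := by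
  rw [← RlocY_one i parS D U]
  exact RlocY_comp_RlocY i parS D (mul_one 1) ((isUnit_padXlocY_one_iff i parS D U).mpr hU)

/-- ★ **`Q′(U) ∘ G′_□(U) ∘ R(U)[G′_□] = 0`** on the unit locus of `X` (the global gauge condition (3.20)–(3.21) at the letter `G′_□`).
[cite: Balaban1985BackgroundPropagators, (3.20)–(3.21) p.394, (3.25) p.394] -/
theorem QpY_GsqY_comp_RY_GsqY {U : CfgY 𝔸 i} (hU : IsUnit (XY i parS (GsqY i parS D) U)) :
    QpY i parS U ∘ₗ GsqY i parS D U ∘ₗ RY i parS (GsqY i parS D) U = 0 := by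
  have h := P_QpY_GsqY_comp_RlocY i parS D (P := 1) (mul_one 1) ((isUnit_padXlocY_one_iff i parS D U).mpr hU)
  rwa [RlocY_one, Module.End.one_eq_id, LinearMap.id_comp] at h

/-- ★ the same two faces at `D = univ`, where `G′_□ = G′ = GpY i parS` (A-0 `GsqY_univ`): `R(U) ∘ R(U) = R(U)` for def-Y's global (3.25) letter
`RY i parS (GpY i parS) U` on the unit locus of `Q′G′G′Q′*(U)`. [cite: Balaban1985BackgroundPropagators, (3.20) p.394, (3.25) p.394] -/
theorem RY_GpY_comp_RY_GpY {U : CfgY 𝔸 i} (hU : IsUnit (XY i parS (GpY i parS) U)) :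
    RY i parS (GpY i parS) U ∘ₗ RY i parS (GpY i parS) U = RY i parS (GpY i parS) U := by
  have h := RY_GsqY_comp_RY_GsqY i parS Finset.univ (U := U) (by rwa [OpsYLocalInverse.GsqY_univ])
  rwa [OpsYLocalInverse.GsqY_univ] at h

/-- … and `Q′(U) ∘ G′(U) ∘ R(U) = 0` there. [cite: Balaban1985BackgroundPropagators, (3.20)–(3.21) p.394, (3.25) p.394] -/
theorem QpY_GpY_comp_RY_GpY {U : CfgY 𝔸 i} (hU : IsUnit (XY i parS (GpY i parS) U)) :
    QpY i parS U ∘ₗ GpY i parS U ∘ₗ RY i parS (GpY i parS) U = 0 := by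
  have h := QpY_GsqY_comp_RY_GsqY i parS Finset.univ (U := U) (by rwa [OpsYLocalInverse.GsqY_univ])
  rwa [OpsYLocalInverse.GsqY_univ] at h

end Literature.MathematicalPhysics.QuantumFieldTheory.Balaban1983to89.Node00.OpsYDeltaALocalProj
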